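import Literature.NumberTheory.LFunctions.LogFreeDensityTheorem14
import Literature.NumberTheory.LFunctions.LogFreeDensityZetaLemmaB
import Literature.NumberTheory.LFunctions.ZetaZeroFreeRegion
import Literature.NumberTheory.LFunctions.ZeroDensityInghamHuxley
import Literature.NumberTheory.LFunctions.WeilZeroSum
import HarnessLib

/-!
# Bombieri's log-free zero-density theorem, the case of `ζ` (`χ = χ₀`)

Topic `Literature/NumberTheory/LFunctions`, sub-namespace `LogFreeDensity`. Everything here is
PROVED: the `q = 1` case of Bombieri's Théorème 14 (*Le grand crible*, §6), in the shape consumed by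
the tree's `lemma43_gallagher_of_explicitFormula_of_density` (hypothesis `hZDζ`): there are absolute
`c_D, C_D > 0` with
`∑_{ρ : ζ(ρ) = 0, 0 ≤ β ≤ 1, 0 < |γ| ≤ P^6, β ≥ α} m(ρ) ≤ C_D P^{c_D(1−α)}` for `P ≥ 2`,
`0 ≤ α ≤ 1` (`logFreeDensity_zeta`). The middle range is Bombieri's argument with `ζ₁ = (s − 1)ζ`
(`zeroSideZeta`, from `LogFreeDensity.lemmeB_zeta`, and the `q = 1` term of the sieve bound of
`LogFreeDensityTheorem14.lean`); near `α = 1` the count is empty by the classical zero-free region of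
`ζ` (no exceptional zero); for `1 − α > δ₀` the count is the trivial `≪ P^7` (the tree's window
counts of `ZeroDensityInghamHuxley.lean` and the reflection `m(1 − ρ) = m(ρ)`).

## References
* [Bombieri1987GrandCrible] §6 Théorème 14, pp. 48–51.
-/

noncomputable section

open Complex Finset Filter Real MeasureTheory
open scoped LSeries.notation ArithmeticFunction.vonMangoldt Topology Nat FourierTransform

namespace Literature.NumberTheory.LFunctions.LogFreeDensity

open Literature.NumberTheory.LFunctions Literature.NumberTheory.Sieve.LargeSieve

/-! ### The zero side for `ζ` -/

/-- The `ζ`-version of `overlap_le`: the multiplicity-weighted number of zeros of `ζ` within `r/2`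
in height of `v` (and `1 − β ≤ r/2`) is at most `C_d(1 + r log(|v|+4))`. [cite: Bombieri1987GrandCrible, §6 Théorème 14 (proof)] -/
theorem overlap_le_zeta {C_d : ℝ}
    (hdens : ∀ (v r : ℝ), 0 < r → r ≤ 1 / 4 →
        ∑ ρ ∈ (zetaDiscZeros v).filter (fun ρ => ‖ρ - (1 + (v : ℂ) * I)‖ ≤ r),
            (zetaDiscDivisor v ρ : ℝ) ≤ C_d * (1 + r * Real.log (|v| + 4)))
    {r : ℝ} (hr : 0 < r) (hr4 : r ≤ 1 / 4)
    (Zρ : Finset ℂ) (hZ : ∀ ρ ∈ Zρ, riemannZeta ρ = 0 ∧ 1 - r / 2 ≤ ρ.re ∧ ρ.re < 1) (v : ℝ) :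
    ∑ ρ ∈ Zρ.filter (fun ρ => |ρ.im - v| ≤ r / 2), ((riemannZetaZeroOrder ρ : ℤ) : ℝ) ≤
      C_d * (1 + r * Real.log (|v| + 4)) := by
  classical
  set W := Zρ.filter (fun ρ => |ρ.im - v| ≤ r / 2) with hW
  -- each `ρ ∈ W` lies in `zetaDiscZeros v` with `|ρ − (1+iv)| ≤ r`
  have hmem : ∀ ρ ∈ W, ρ ∈ zetaDiscZeros v ∧ ‖ρ - (1 + (v : ℂ) * I)‖ ≤ r := by
    intro ρ hρ
    rw [hW, mem_filter] at hρ
    obtain ⟨hρZ, hγ⟩ := hρ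
    obtain ⟨h0, hβ, hβ1⟩ := hZ ρ hρZ
    have hnorm : ‖ρ - (1 + (v : ℂ) * I)‖ ≤ r := by
      have hre : (ρ - (1 + (v : ℂ) * I)).re = ρ.re - 1 := by simp
      have him : (ρ - (1 + (v : ℂ) * I)).im = ρ.im - v := by simp
      calc ‖ρ - (1 + (v : ℂ) * I)‖ ≤ |(ρ - (1 + (v : ℂ) * I)).re| + |(ρ - (1 + (v : ℂ) * I)).im| :=
            Complex.norm_le_abs_re_add_abs_im _
        _ ≤ r / 2 + r / 2 := by
            rw [hre, him]
            refine add_le_add ?_ hγ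
            rw [abs_sub_comm, abs_of_nonneg (by linarith)]; linarith
        _ = r := by ring
    have hne1 : ρ ≠ 1 := by
      intro h; rw [h, one_re] at hβ1; exact lt_irrefl _ hβ1
    refine ⟨mem_zetaDiscZeros.2 ⟨?_, (riemannZeta₁_eq_zero_iff hne1).2 h0⟩, hnorm⟩
    rw [Metric.mem_closedBall, dist_eq_norm]
    calc ‖ρ - (2 + (v : ℂ) * I)‖ = ‖(ρ - (1 + (v : ℂ) * I)) - 1‖ := by ring_nf
      _ ≤ ‖ρ - (1 + (v : ℂ) * I)‖ + ‖(1 : ℂ)‖ := norm_sub_le _ _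
      _ ≤ r + 1 := by rw [norm_one]; linarith
      _ ≤ 37 / 20 := by linarith
  have hsub : W ⊆ (zetaDiscZeros v).filter (fun ρ => ‖ρ - (1 + (v : ℂ) * I)‖ ≤ r) := by
    intro ρ hρ; rw [mem_filter]; exact hmem ρ hρ
  calc ∑ ρ ∈ W, ((riemannZetaZeroOrder ρ : ℤ) : ℝ) = ∑ ρ ∈ W, (zetaDiscDivisor v ρ : ℝ) := by
        refine sum_congr rfl fun ρ hρ => ?_
        rw [(zetaDiscZeros_prop (hmem ρ hρ).1).2.2.2.2.1]
    _ ≤ ∑ ρ ∈ (zetaDiscZeros v).filter (fun ρ => ‖ρ - (1 + (v : ℂ) * I)‖ ≤ r), (zetaDiscDivisor v ρ : ℝ) :=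
        sum_le_sum_of_subset_of_nonneg hsub fun ρ _ _ => by exact_mod_cast zetaDiscDivisor_nonneg v ρ
    _ ≤ _ := hdens v r hr hr4

/-- **The zero side of Théorème 14 for `ζ`** (as `zeroSide`, with `lemmeB_zeta` and the density lemma
for `ζ`; the zeros are taken at heights `|γ| ≥ 3 + r/2`, where the pole of `ζ` does not interfere):
`r · (e^{−10}/4) x^{−r/10} r^{−3} · ∑_{ρ ∈ Z} m(ρ) ≤ C (rL') ∫_{−T'}^{T'} I_{χ₀}(v) dv`.
[cite: Bombieri1987GrandCrible, §6 Théorème 14 (proof)] -/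
theorem zeroSideZeta :
    ∃ A₀ r₀ C : ℝ, 0 < A₀ ∧ 0 < r₀ ∧ 0 < C ∧
      ∀ (T' r L' x : ℝ) (z : ℕ) (Zρ : Finset ℂ),
        Real.log (T' + 4) ≤ L' → 0 < r → r ≤ r₀ → 1 ≤ r * L' → 1 ≤ x →
        A₀ * L' ≤ Real.log x → (z : ℝ) ≤ x ^ (expoB / 2) → 0 ≤ T' →
        (∀ ρ ∈ Zρ, riemannZeta ρ = 0 ∧ 1 - r / 2 ≤ ρ.re ∧ ρ.re < 1 ∧ 3 + r / 2 ≤ |ρ.im| ∧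
          |ρ.im| + r / 2 ≤ T') →
          r * (Real.exp (-10) / 4 * x ^ (-(r / 10)) / r ^ 3) *
              ∑ ρ ∈ Zρ, ((riemannZetaZeroOrder ρ : ℤ) : ℝ) ≤
            C * (r * L') * ∫ v in (-T')..T', meanValue (1 : DirichletCharacter ℂ 1) x z v := by
  obtain ⟨A₀, r₀, hA₀, hr₀, hB⟩ := lemmeB_zeta
  obtain ⟨C_d, hC_d, hdens⟩ := exists_sum_near_le_zeta
  refine ⟨A₀, min r₀ (1 / 4), 2 * C_d, hA₀, by positivity, by positivity,
    fun T' r L' x z Zρ hLL' hr hrmin hu hx hlogx hz hT' hZ => ?_⟩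
  classical
  have hr0 : r ≤ r₀ := hrmin.trans (min_le_left _ _)
  have hr4 : r ≤ 1 / 4 := hrmin.trans (min_le_right _ _)
  set χ₁ : DirichletCharacter ℂ 1 := 1 with hχ₁
  set L₀ : ℝ := Real.exp (-10) / 4 * x ^ (-(r / 10)) / r ^ 3 with hL₀
  set A : Set ℝ := Set.Icc (-T') T' with hA
  have hxpos : 0 < x := by linarith
  -- `x^{a₀} ≥ 1`, needed for the integrability lemmas
  have hNX : 1 ≤ ⌊x ^ expoB⌋₊ := Nat.le_floor (by
    simp only [Nat.cast_one]; exact Real.one_le_rpow hx expoB_pos.le)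
  have hint : IntegrableOn (meanValue χ₁ x z) A := integrableOn_meanValue χ₁ hx z hNX _ _
  -- Lemme B at every `v` within `r/2` of the height of a zero of `Z`
  have hLB : ∀ ρ ∈ Zρ, ∀ v ∈ Set.Icc (ρ.im - r / 2) (ρ.im + r / 2), L₀ ≤ meanValue χ₁ x z v := by
    intro ρ hρ v hv
    obtain ⟨h0, hβ, hβ1, hγ3, hγT⟩ := hZ ρ hρ
    have hvT : |v| ≤ T' := by
      rw [Set.mem_Icc] at hv
      have h1 : |ρ.im| ≤ T' - r / 2 := by linarith
      have h2 := abs_le.1 h1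
      rw [abs_le]; constructor <;> linarith
    have hLL'v : Real.log (|v| + 4) ≤ L' := by
      have := Real.log_le_log (by positivity) (show |v| + 4 ≤ T' + 4 by linarith)
      linarith
    have hv3 : 3 ≤ |v| := by
      rw [Set.mem_Icc] at hv
      have h1 : |ρ.im| - r / 2 ≤ |v| := by
        have := abs_sub_abs_le_abs_sub ρ.im v
        have h2 : |ρ.im - v| ≤ r / 2 := by rw [abs_le]; constructor <;> linarith
        linarith
      linarith
    -- the zero is within `r` of `1 + iv` and in the disc
    have hγ : |ρ.im - v| ≤ r / 2 := by
      rw [Set.mem_Icc] at hv; rw [abs_le]; constructor <;> linarith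
    have hnorm : ‖ρ - (1 + (v : ℂ) * I)‖ ≤ r := by
      have hre : (ρ - (1 + (v : ℂ) * I)).re = ρ.re - 1 := by simp
      have him : (ρ - (1 + (v : ℂ) * I)).im = ρ.im - v := by simp
      calc ‖ρ - (1 + (v : ℂ) * I)‖ ≤ |(ρ - (1 + (v : ℂ) * I)).re| + |(ρ - (1 + (v : ℂ) * I)).im| :=
            Complex.norm_le_abs_re_add_abs_im _
        _ ≤ r / 2 + r / 2 := by
            rw [hre, him]
            refine add_le_add ?_ hγ
            rw [abs_sub_comm, abs_of_nonneg (by linarith)]; linarith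
        _ = r := by ring
    have hne1 : ρ ≠ 1 := by
      intro h; rw [h, one_re] at hβ1; exact lt_irrefl _ hβ1
    have hdisc : ρ ∈ zetaDiscZeros v := by
      refine mem_zetaDiscZeros.2 ⟨?_, (riemannZeta₁_eq_zero_iff hne1).2 h0⟩
      rw [Metric.mem_closedBall, dist_eq_norm]
      calc ‖ρ - (2 + (v : ℂ) * I)‖ = ‖(ρ - (1 + (v : ℂ) * I)) - 1‖ := by ring_nf
        _ ≤ ‖ρ - (1 + (v : ℂ) * I)‖ + ‖(1 : ℂ)‖ := norm_sub_le _ _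
        _ ≤ r + 1 := by rw [norm_one]; linarith
        _ ≤ 37 / 20 := by linarith
    exact hB v r L' x z hLL'v hr hr0 hv3 hu ⟨ρ, hdisc, hnorm⟩ hxpos hlogx hz
  -- per zero: `r L₀ ≤ ∫_A 𝟙_{J_ρ} I`
  have hper : ∀ ρ ∈ Zρ, r * L₀ ≤
      ∫ v in A, (Set.Icc (ρ.im - r / 2) (ρ.im + r / 2)).indicator (meanValue χ₁ x z) v := by
    intro ρ hρ
    obtain ⟨-, -, -, -, hγT⟩ := hZ ρ hρ
    set J : Set ℝ := Set.Icc (ρ.im - r / 2) (ρ.im + r / 2) with hJ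
    have hJA : J ⊆ A := by
      intro v hv
      rw [hJ, Set.mem_Icc] at hv
      rw [hA, Set.mem_Icc]
      have h1 : |ρ.im| ≤ T' - r / 2 := by linarith
      have h2 := abs_le.1 h1
      constructor <;> linarith
    rw [setIntegral_indicator measurableSet_Icc, Set.inter_eq_right.2 hJA]
    have hvol : volume.real J = r := by
      rw [hJ, Measure.real, Real.volume_Icc, ENNReal.toReal_ofReal (by linarith)]; ring
    have h := setIntegral_ge_of_const_le_real (c := L₀) measurableSet_Icc measure_Icc_lt_top.ne
      (fun v hv => hLB ρ hρ v hv) (hint.mono_set hJA)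
    rw [hvol] at h
    linarith
  -- sum over the zeros and bound the overlap
  have hord0 : ∀ ρ ∈ Zρ, (0 : ℝ) ≤ ((riemannZetaZeroOrder ρ : ℤ) : ℝ) := by
    intro ρ hρ
    have hne1 : ρ ≠ 1 := by
      intro h; have := (hZ ρ hρ).2.2.1; rw [h, one_re] at this; exact lt_irrefl _ this
    exact_mod_cast riemannZetaZeroOrder_nonneg hne1
  have hsum : r * L₀ * ∑ ρ ∈ Zρ, ((riemannZetaZeroOrder ρ : ℤ) : ℝ) ≤
      ∫ v in A, ∑ ρ ∈ Zρ, ((riemannZetaZeroOrder ρ : ℤ) : ℝ) *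
        (Set.Icc (ρ.im - r / 2) (ρ.im + r / 2)).indicator (meanValue χ₁ x z) v := by
    rw [mul_sum, integral_finsetSum _ fun ρ _ => (hint.indicator measurableSet_Icc).const_mul _]
    refine sum_le_sum fun ρ hρ => ?_
    rw [integral_const_mul]
    have h0 := hord0 ρ hρ
    calc r * L₀ * ((riemannZetaZeroOrder ρ : ℤ) : ℝ) = ((riemannZetaZeroOrder ρ : ℤ) : ℝ) * (r * L₀) := by ring
      _ ≤ _ := mul_le_mul_of_nonneg_left (hper ρ hρ) h0
  refine hsum.trans ?_
  -- pointwise overlap bound on `A`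
  have hℒ : ∀ v ∈ A, Real.log (|v| + 4) ≤ L' := by
    intro v hv
    rw [hA, Set.mem_Icc] at hv
    have hvT : |v| ≤ T' := abs_le.2 ⟨hv.1, hv.2⟩
    have := Real.log_le_log (by positivity) (show |v| + 4 ≤ T' + 4 by linarith)
    linarith
  have hpt : ∀ v ∈ A, ∑ ρ ∈ Zρ, ((riemannZetaZeroOrder ρ : ℤ) : ℝ) *
      (Set.Icc (ρ.im - r / 2) (ρ.im + r / 2)).indicator (meanValue χ₁ x z) v ≤
        (2 * C_d * (r * L')) * meanValue χ₁ x z v := by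
    intro v hv
    have heq : ∑ ρ ∈ Zρ, ((riemannZetaZeroOrder ρ : ℤ) : ℝ) *
        (Set.Icc (ρ.im - r / 2) (ρ.im + r / 2)).indicator (meanValue χ₁ x z) v =
        (∑ ρ ∈ Zρ.filter (fun ρ => |ρ.im - v| ≤ r / 2), ((riemannZetaZeroOrder ρ : ℤ) : ℝ)) *
          meanValue χ₁ x z v := by
      rw [sum_mul, sum_filter]
      refine sum_congr rfl fun ρ _ => ?_
      by_cases h : |ρ.im - v| ≤ r / 2
      · rw [if_pos h, Set.indicator_of_mem]
        rw [Set.mem_Icc]; rw [abs_le] at h; constructor <;> linarith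
      · rw [if_neg h, Set.indicator_of_notMem, mul_zero]
        rw [Set.mem_Icc]; intro h'; exact h (abs_le.2 ⟨by linarith, by linarith⟩)
    rw [heq]
    refine mul_le_mul_of_nonneg_right ?_ (meanValue_nonneg χ₁ x z v)
    have h1 := overlap_le_zeta hdens hr hr4 Zρ (fun ρ hρ => ⟨(hZ ρ hρ).1, (hZ ρ hρ).2.1, (hZ ρ hρ).2.2.1⟩) v
    have h2 : C_d * (1 + r * Real.log (|v| + 4)) ≤ 2 * C_d * (r * L') := by
      have := hℒ v hv
      have h3 : r * Real.log (|v| + 4) ≤ r * L' := mul_le_mul_of_nonneg_left this hr.le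
      nlinarith [hC_d, hu]
    exact h1.trans h2
  have hi1 : IntegrableOn (fun v => ∑ ρ ∈ Zρ, ((riemannZetaZeroOrder ρ : ℤ) : ℝ) *
      (Set.Icc (ρ.im - r / 2) (ρ.im + r / 2)).indicator (meanValue χ₁ x z) v) A :=
    integrable_finsetSum _ fun ρ _ => (hint.indicator measurableSet_Icc).const_mul _
  calc ∫ v in A, ∑ ρ ∈ Zρ, ((riemannZetaZeroOrder ρ : ℤ) : ℝ) *
        (Set.Icc (ρ.im - r / 2) (ρ.im + r / 2)).indicator (meanValue χ₁ x z) v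
      ≤ ∫ v in A, (2 * C_d * (r * L')) * meanValue χ₁ x z v :=
        setIntegral_mono_on hi1 (hint.const_mul _) measurableSet_Icc hpt
    _ = (2 * C_d * (r * L')) * ∫ v in (-T')..T', meanValue χ₁ x z v := by
        rw [integral_const_mul, hA, integral_Icc_eq_integral_Ioc,
          ← intervalIntegral.integral_of_le (by linarith)]


/-! ### The middle range for `ζ` -/

set_option maxHeartbeats 800000 in
open scoped Classical in
/-- **Théorème 14 for `ζ` in the middle range**: for every `c₀ > 0` there are `δ₀, A, C > 0` such
that for `P ≥ 2` and `c₀/log P ≤ 1 − α ≤ δ₀`, the non-trivial zeros of `ζ` with `β ≥ α`,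
`|γ| ≤ P^6` have `∑ m(ρ) ≤ C P^{A(1−α)}` (the case `q = 1` of Bombieri's sum; the zeros lie at
heights `|γ| > 4` by the zero-free region, so the pole is harmless). [cite: Bombieri1987GrandCrible, §6 Théorème 14] -/
theorem middleRangeZeta {c₀ : ℝ} (hc₀ : 0 < c₀) :
    ∃ δ₀ A C : ℝ, 0 < δ₀ ∧ 0 < A ∧ 0 < C ∧
      ∀ P : ℝ, 2 ≤ P → ∀ α : ℝ, c₀ / Real.log P ≤ 1 - α → 1 - α ≤ δ₀ →
        ∑ ρ ∈ (weilZeroIndex_finite (P ^ 6)).toFinset with α ≤ ρ.re,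
          ((riemannZetaZeroOrder ρ : ℤ) : ℝ) ≤ C * P ^ (A * (1 - α)) := by
  obtain ⟨A₀, r₀, C_z, hA₀, hr₀, hC_z, hZS⟩ := zeroSideZeta
  obtain ⟨c_ζ, hc_ζ, hZF⟩ := classicalZFRData_riemannZeta.zeroFree
  set C_H : ℝ := π ^ 2 * (π * Real.exp π / 2 + 2) with hC_H
  have hC_Hpos : 0 < C_H := by rw [hC_H]; positivity
  set a : ℝ := expoB with ha
  have hapos : 0 < a := expoB_pos
  set A₁ : ℝ := max A₀ (2 / a) with hA₁
  have hA₁pos : 0 < A₁ := lt_of_lt_of_le hA₀ (le_max_left _ _)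
  have hA₁A₀ : A₀ ≤ A₁ := le_max_left _ _
  have hA₁a : 2 / a ≤ A₁ := le_max_right _ _
  set B : ℝ := max 8 (1 / (2 * c₀)) with hB
  have hB8 : 8 ≤ B := le_max_left _ _
  have hBc : 1 / (2 * c₀) ≤ B := le_max_right _ _
  have hBpos : 0 < B := by linarith
  set K₁ : ℝ := 2 * C_z * C_H * A₁ ^ 3 * B ^ 4 with hK₁
  have hlog8 : 0 < Real.log 8 := Real.log_pos (by norm_num)
  refine ⟨min (min (r₀ / 2) (1 / 4)) (c_ζ / (2 * Real.log 8)), (A₁ * B / 10 + 3) * 2, 4 * K₁ * Real.exp 10,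
    by positivity, by positivity, by positivity, fun P hP α hα1 hα2 => ?_⟩
  /- ── parameters ── -/
  have hPpos : 0 < P := by linarith
  set Lp : ℝ := Real.log P with hLp
  have hLp2 : Real.log 2 ≤ Lp := Real.log_le_log (by norm_num) hP
  have hlog2 : (0.69 : ℝ) ≤ Real.log 2 := by have := Real.log_two_gt_d9; linarith
  have hLppos : 0 < Lp := by linarith
  set r : ℝ := 2 * (1 - α) with hr
  have hδ : 1 - α ≤ r₀ / 2 := hα2.trans ((min_le_left _ _).trans (min_le_left _ _))
  have hδ' : 1 - α ≤ 1 / 4 := hα2.trans ((min_le_left _ _).trans (min_le_right _ _))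
  have hδζ : 1 - α ≤ c_ζ / (2 * Real.log 8) := hα2.trans (min_le_right _ _)
  have h1α : c₀ / Lp ≤ 1 - α := hα1
  have h1αpos : 0 < 1 - α := lt_of_lt_of_le (by positivity) h1α
  have hrpos : 0 < r := by rw [hr]; linarith
  have hrr₀ : r ≤ r₀ := by rw [hr]; linarith
  have hr1 : r ≤ 1 := by rw [hr]; linarith
  have hrhalf : r ≤ 1 / 2 := by rw [hr]; linarith
  set L' : ℝ := B * Lp with hL'
  have hL'8 : 8 * Lp ≤ L' := by rw [hL']; exact mul_le_mul_of_nonneg_right hB8 hLppos.le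
  have hu : 1 ≤ r * L' := by
    rw [hr, hL']
    have h1 : c₀ ≤ (1 - α) * Lp := by rwa [div_le_iff₀ hLppos] at h1α
    have h2 : 1 ≤ 2 * c₀ * B := by
      rw [div_le_iff₀ (by positivity)] at hBc; linarith
    calc (1 : ℝ) ≤ 2 * c₀ * B := h2
      _ ≤ 2 * ((1 - α) * Lp) * B := by nlinarith only [h1, hBpos, hc₀]
      _ = 2 * (1 - α) * (B * Lp) := by ring
  set Lx : ℝ := A₁ * L' with hLx
  set x : ℝ := Real.exp Lx with hx
  have hxpos : 0 < x := Real.exp_pos _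
  have hlogx : Real.log x = Lx := Real.log_exp _
  have hLxA₀ : A₀ * L' ≤ Real.log x := by
    rw [hlogx, hLx]; exact mul_le_mul_of_nonneg_right hA₁A₀ (by positivity)
  have hLx16 : 16 * Lp ≤ a * Lx := by
    rw [hLx]
    have : 2 / a * (8 * Lp) ≤ A₁ * L' :=
      mul_le_mul hA₁a hL'8 (by positivity) hA₁pos.le
    have h2 : a * (2 / a * (8 * Lp)) = 16 * Lp := by field_simp; ring
    calc 16 * Lp = a * (2 / a * (8 * Lp)) := h2.symm
      _ ≤ a * (A₁ * L') := mul_le_mul_of_nonneg_left this hapos.le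
  have hLxnn : 0 ≤ Lx := by rw [hLx]; positivity
  have hLx4 : 4 ≤ Lx := by
    have h1 : a * Lx ≤ Lx / 2 := by nlinarith only [expoB_le_half, hLxnn, ha]
    linarith
  have hx1 : 1 ≤ x := by rw [hx]; exact Real.one_le_exp (by linarith)
  set T' : ℝ := P ^ 6 + 1 with hT'
  have hT'1 : 1 ≤ T' := by rw [hT']; have := pow_nonneg hPpos.le 6; linarith
  have hT'0 : 0 ≤ T' := by linarith
  have hT'pos : 0 < T' := by linarith
  /- ── `NX = ⌊x^{a₀}⌋ ≥ P^16 − 1` and `z` ── -/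
  set NX : ℕ := ⌊x ^ a⌋₊ with hNX
  have hxa : x ^ a = Real.exp (a * Lx) := by rw [hx, ← Real.exp_mul, mul_comm]
  have hP16 : P ^ (16 : ℕ) ≤ x ^ a := by
    rw [hxa]
    calc P ^ (16 : ℕ) = Real.exp (16 * Lp) := by
          rw [hLp, ← Real.exp_log (pow_pos hPpos 16), Real.log_pow]; norm_num
      _ ≤ Real.exp (a * Lx) := Real.exp_le_exp.2 hLx16
  have hP16' : (2 : ℝ) ^ (16 : ℕ) ≤ P ^ (16 : ℕ) := pow_le_pow_left₀ (by norm_num) hP 16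
  have hNXle : (NX : ℝ) ≤ x ^ a := Nat.floor_le (by positivity)
  have hNXgt : x ^ a < NX + 1 := Nat.lt_floor_add_one _
  have hNX1 : 1 ≤ NX := Nat.le_floor (by
    simp only [Nat.cast_one]; linarith only [hP16, hP16', (by norm_num : (1:ℝ) ≤ 2 ^ 16)])
  have hNXhalf : P ^ (16 : ℕ) / 2 ≤ NX := by
    linarith only [hP16, hP16', hNXgt, (by norm_num : (2:ℝ) ≤ 2 ^ 16)]
  have hNXpos : (0 : ℝ) < NX := by exact_mod_cast hNX1
  set z : ℕ := ⌊Real.sqrt (NX / T')⌋₊ with hz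
  have hsqrt0 : 0 ≤ Real.sqrt (NX / T') := Real.sqrt_nonneg _
  have hzle : (z : ℝ) ≤ Real.sqrt (NX / T') := Nat.floor_le hsqrt0
  have hzgt : Real.sqrt (NX / T') < z + 1 := Nat.lt_floor_add_one _
  have hzsq : (z : ℝ) ^ 2 * T' ≤ NX := by
    have h1 : (z : ℝ) ^ 2 ≤ NX / T' := by
      calc (z : ℝ) ^ 2 ≤ (Real.sqrt (NX / T')) ^ 2 := pow_le_pow_left₀ (Nat.cast_nonneg z) hzle 2
        _ = NX / T' := Real.sq_sqrt (by positivity)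
    rwa [le_div_iff₀ (by positivity)] at h1
  have hzx : (z : ℝ) ^ 2 * T' ≤ ⌊x ^ expoB⌋₊ + 1 := by rw [← ha, ← hNX]; linarith
  have hzhalf : (z : ℝ) ≤ x ^ (expoB / 2) := by
    rw [← ha]
    have h1 : Real.sqrt (NX / T') ≤ Real.sqrt (x ^ a) := by
      refine Real.sqrt_le_sqrt ?_
      calc (NX : ℝ) / T' ≤ NX := div_le_self hNXpos.le hT'1
        _ ≤ x ^ a := hNXle
    have h2 : Real.sqrt (x ^ a) = x ^ (a / 2) := by
      rw [Real.sqrt_eq_rpow, ← Real.rpow_mul hxpos.le]; ring_nf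
    linarith [h1.trans_eq h2]
  -- `z ≥ P^5/2 − 1 ≥ P²`, hence `z > ⌊P⌋` and `log(z/⌊P⌋) ≥ log P`
  have hT'le : T' ≤ 2 * P ^ (6 : ℕ) := by
    rw [hT']; have : (1 : ℝ) ≤ P ^ (6 : ℕ) := one_le_pow₀ (by linarith); linarith
  have hzlow : P ^ (5 : ℕ) / 2 - 1 ≤ z := by
    have h1 : P ^ (10 : ℕ) / 4 ≤ NX / T' := by
      rw [div_le_div_iff₀ (by norm_num) (by positivity)]
      have hp16 : P ^ (16 : ℕ) = P ^ (10 : ℕ) * P ^ (6 : ℕ) := by rw [← pow_add]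
      have h10 : 0 ≤ P ^ (10 : ℕ) := pow_nonneg hPpos.le 10
      have := mul_le_mul_of_nonneg_left hT'le h10
      nlinarith only [hNXhalf, this, hp16]
    have h2 : P ^ (5 : ℕ) / 2 ≤ Real.sqrt (NX / T') := by
      rw [Real.le_sqrt (by positivity) (div_nonneg hNXpos.le hT'0)]
      calc (P ^ (5 : ℕ) / 2) ^ 2 = P ^ (10 : ℕ) / 4 := by ring
        _ ≤ _ := h1
    linarith
  have hP5 : P ^ (2 : ℕ) + P + 1 ≤ P ^ (5 : ℕ) / 2 - 1 := by
    have hP2 : (4 : ℝ) ≤ P ^ (2 : ℕ) := by nlinarith only [hP]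
    have hP3 : P ^ (5 : ℕ) = P ^ (2 : ℕ) * P ^ (2 : ℕ) * P := by ring
    have hP4 : (16 : ℝ) * P ≤ P ^ (2 : ℕ) * P ^ (2 : ℕ) * P := by nlinarith only [hP2, hPpos]
    nlinarith only [hP3, hP4, hP, hP2]
  have hzP2 : P ^ (2 : ℕ) + P + 1 ≤ z := hP5.trans hzlow
  have hPfloor : (⌊P⌋₊ : ℝ) ≤ P := Nat.floor_le hPpos.le
  have hQ₁1 : 1 ≤ ⌊P⌋₊ := Nat.le_floor (by simp only [Nat.cast_one]; linarith)
  have hQ₁z : ⌊P⌋₊ < z := by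
    have : (⌊P⌋₊ : ℝ) < z := by nlinarith only [hzP2, hPfloor, hPpos]
    exact_mod_cast this
  have hlogz : Lp ≤ Real.log ((z : ℝ) / ⌊P⌋₊) := by
    have hQpos : (0 : ℝ) < ⌊P⌋₊ := by exact_mod_cast hQ₁1
    rw [hLp]
    refine Real.log_le_log hPpos ?_
    rw [le_div_iff₀ hQpos]
    calc P * ⌊P⌋₊ ≤ P * P := mul_le_mul_of_nonneg_left hPfloor hPpos.le
      _ ≤ z := by nlinarith only [hzP2, hPpos]
  /- ── the sieve side for every `t ∈ (NX, x]` ── -/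
  set Bt : ℝ := C_H / Lp * (2 * Lx ^ 2) with hBt
  have hsieve : ∀ t ∈ Set.Ioc (NX : ℝ) x,
      ∑ q ∈ Icc 1 ⌊P⌋₊, ∑ χ : DirichletCharacter ℂ q with χ.IsPrimitive,
        ∫ v in (-T')..T', ‖summatory (coefSifted χ v x z) t‖ ^ 2 ≤ Bt := by
    intro t ht
    refine (sieveSide hQ₁1 hQ₁z hT'1 hzx t).trans ?_
    have h1 : C_H / Real.log ((z : ℝ) / ⌊P⌋₊) ≤ C_H / Lp :=
      div_le_div_of_nonneg_left hC_Hpos.le hLppos hlogz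
    have h2 : ∑ n ∈ (siftedSet x z).filter (fun n => n ≤ ⌊t⌋₊), Λ n ^ 2 / n ≤ 2 * Lx ^ 2 := by
      have hsub : (siftedSet x z).filter (fun n => n ≤ ⌊t⌋₊) ⊆ Icc 1 ⌊x⌋₊ := by
        intro n hn
        rw [mem_filter] at hn
        obtain ⟨h1, h2, -⟩ := siftedSet_prop hn.1
        rw [mem_Icc]; omega
      refine (sum_le_sum_of_subset_of_nonneg hsub fun n _ _ => by positivity).trans ?_
      refine (sum_vonMangoldt_sq_div_le ⌊x⌋₊).trans ?_
      have hfl : Real.log ⌊x⌋₊ ≤ Lx := by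
        rw [← hlogx]
        rcases Nat.eq_zero_or_pos ⌊x⌋₊ with h0 | hpos
        · rw [h0, Nat.cast_zero, Real.log_zero, hlogx]; linarith
        · exact Real.log_le_log (by exact_mod_cast hpos) (Nat.floor_le hxpos.le)
      have hfl0 : 0 ≤ Real.log ⌊x⌋₊ := Real.log_natCast_nonneg _
      have hl4 : Real.log 4 ≤ 1.4 := by
        have h : Real.log 4 = 2 * Real.log 2 := by
          rw [show (4:ℝ) = 2 ^ 2 by norm_num, Real.log_pow]; norm_num
        rw [h]; have := Real.log_two_lt_d9; linarith
      have h5 : Real.log ⌊x⌋₊ * (Real.log ⌊x⌋₊ + Real.log 4 + 2) ≤ Lx * (Lx + 4) :=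
        mul_le_mul hfl (by linarith) (by linarith [Real.log_nonneg (by norm_num : (1:ℝ) ≤ 4)]) hLxnn
      nlinarith only [h5, hLx4]
    exact mul_le_mul h1 h2 (sum_nonneg fun n _ => by positivity) (by positivity)
  /- ── the zero side for `ζ` ── -/
  set L₀ : ℝ := Real.exp (-10) / 4 * x ^ (-(r / 10)) / r ^ 3 with hL₀
  have hL₀pos : 0 < L₀ := by rw [hL₀]; positivity
  have hLL' : Real.log (T' + 4) ≤ L' := by
    have hP6 : (64 : ℝ) ≤ P ^ (6 : ℕ) := by
      calc (64 : ℝ) = 2 ^ (6 : ℕ) := by norm_num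
        _ ≤ P ^ (6 : ℕ) := pow_le_pow_left₀ (by norm_num) hP 6
    have h3 : T' + 4 ≤ 2 * P ^ (6 : ℕ) := by rw [hT']; linarith
    calc Real.log (T' + 4) ≤ Real.log (2 * P ^ (6 : ℕ)) := Real.log_le_log (by linarith) h3
      _ = Real.log 2 + 6 * Lp := by
          rw [Real.log_mul (by norm_num) (by positivity), Real.log_pow]; norm_num; rfl
      _ ≤ 7 * Lp := by linarith
      _ ≤ L' := by linarith
  set F : Finset ℂ := ((weilZeroIndex_finite (P ^ 6)).toFinset).filter (fun ρ => α ≤ ρ.re) with hF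
  have hFprop : ∀ ρ ∈ F, riemannZeta ρ = 0 ∧ 1 - r / 2 ≤ ρ.re ∧ ρ.re < 1 ∧ 3 + r / 2 ≤ |ρ.im| ∧
      |ρ.im| + r / 2 ≤ T' := by
    intro ρ hρ
    rw [hF, mem_filter, Set.Finite.mem_toFinset] at hρ
    obtain ⟨⟨h0, hre0, hre1, him0, himT⟩, hα⟩ := hρ
    have hre1' : ρ.re < 1 := by
      by_contra h; exact riemannZeta_ne_zero_of_one_le_re (not_lt.1 h) h0
    have hne1 : ρ ≠ 1 := by intro h; rw [h, one_re] at hre1'; exact lt_irrefl _ hre1'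
    have hβ : 1 - r / 2 ≤ ρ.re := by rw [hr]; linarith
    -- zero-free region: `log(|γ| + 4) ≥ c_ζ/δ₀ ≥ 2 log 8`, so `|γ| > 4`
    have hγ : 3 + r / 2 ≤ |ρ.im| := by
      have hζ1 : riemannZeta₁ ρ = 0 := (riemannZeta₁_eq_zero_iff hne1).2 h0
      have hlogpos : 0 < Real.log (|ρ.im| + 4) := Real.log_pos (by linarith [abs_nonneg ρ.im])
      by_contra hlt
      push Not at hlt
      have h8 : Real.log (|ρ.im| + 4) ≤ Real.log 8 := Real.log_le_log (by positivity) (by linarith)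
      refine hZF ρ (by norm_num; linarith) ?_ hζ1
      -- `1 − c_ζ/log(|γ|+4) < ρ.re`
      have h1 : 1 - α ≤ c_ζ / (2 * Real.log 8) := hδζ
      have h2 : c_ζ / (2 * Real.log 8) < c_ζ / Real.log (|ρ.im| + 4) := by
        rw [div_lt_div_iff₀ (by positivity) hlogpos]; nlinarith
      linarith
    refine ⟨h0, hβ, hre1', hγ, ?_⟩
    rw [hT']; linarith
  have hzero : r * L₀ * ∑ ρ ∈ F, ((riemannZetaZeroOrder ρ : ℤ) : ℝ) ≤
      C_z * (r * L') * ∫ v in (-T')..T', meanValue (1 : DirichletCharacter ℂ 1) x z v :=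
    hZS T' r L' x z F hLL' hrpos hrr₀ hu hx1 hLxA₀ hzhalf hT'0 hFprop
  /- ── the `q = 1` term of the sieve sum ── -/
  set S : ℝ := ∑ ρ ∈ F, ((riemannZetaZeroOrder ρ : ℤ) : ℝ) with hS
  set f : ℕ → ℝ := fun q => ∑ χ : DirichletCharacter ℂ q with χ.IsPrimitive,
      ∫ v in (-T')..T', meanValue χ x z v with hf
  have hf0 : ∀ q, 0 ≤ f q := fun q => sum_nonneg fun χ _ =>
      intervalIntegral.integral_nonneg (by linarith) fun v _ => meanValue_nonneg χ x z v
  have hstep1 : r * L₀ * S ≤ C_z * (r * L') * ∑ q ∈ Icc 1 ⌊P⌋₊, f q := by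
    refine hzero.trans (mul_le_mul_of_nonneg_left ?_ (by positivity))
    have h1 : ∫ v in (-T')..T', meanValue (1 : DirichletCharacter ℂ 1) x z v ≤ f 1 := by
      rw [hf]; dsimp only
      refine single_le_sum (f := fun χ : DirichletCharacter ℂ 1 => ∫ v in (-T')..T', meanValue χ x z v)
        (fun χ _ => intervalIntegral.integral_nonneg (by linarith) fun v _ => meanValue_nonneg χ x z v) ?_
      rw [mem_filter]; exact ⟨mem_univ _, DirichletCharacter.isPrimitive_one_level_one⟩
    have h2 : f 1 ≤ ∑ q ∈ Icc 1 ⌊P⌋₊, f q :=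
      single_le_sum (fun q _ => hf0 q) (by rw [mem_Icc]; exact ⟨le_rfl, hQ₁1⟩)
    exact h1.trans h2
  -- Fubini and the sieve bound
  have hNXx : (NX : ℝ) ≤ x := by
    refine hNXle.trans ?_
    rw [ha]
    exact Real.rpow_le_self_of_one_le hx1 (by linarith [expoB_le_half])
  have hstep3 : ∑ q ∈ Icc 1 ⌊P⌋₊, f q ≤ Bt * Lx := by
    -- rewrite every `f q` as a `t`-integral
    set g : (q : ℕ) → DirichletCharacter ℂ q → ℝ → ℝ := fun q χ t =>
      (∫ v in (-T')..T', ‖summatory (coefSifted χ v x z) t‖ ^ 2) / t with hg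
    have hgi : ∀ (q : ℕ) (χ : DirichletCharacter ℂ q), IntegrableOn (g q χ) (Set.Ioc (NX : ℝ) x) :=
      fun q χ => integrableOn_inner χ x z hNX1 hT'0
    have heq : ∀ q, f q = ∫ t in Set.Ioc (NX : ℝ) x,
        ∑ χ : DirichletCharacter ℂ q with χ.IsPrimitive, g q χ t := by
      intro q
      rw [hf]; dsimp only
      rw [integral_finsetSum _ fun χ _ => hgi q χ]
      refine sum_congr rfl fun χ _ => ?_
      exact integral_meanValue_eq χ x z hNX1 hT'0
    rw [sum_congr rfl fun q _ => heq q,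
      ← integral_finsetSum _ fun q _ => integrable_finsetSum _ fun χ _ => hgi q χ]
    -- pointwise bound by `Bt / t`
    have hBtint : IntegrableOn (fun t : ℝ => Bt * t⁻¹) (Set.Ioc (NX : ℝ) x) := by
      refine ((continuousOn_const.mul (continuousOn_inv₀.mono ?_)).integrableOn_compact isCompact_Icc).mono_set
        Set.Ioc_subset_Icc_self
      intro t ht; exact (hNXpos.trans_le ht.1).ne'
    calc ∫ t in Set.Ioc (NX : ℝ) x, ∑ q ∈ Icc 1 ⌊P⌋₊,
          ∑ χ : DirichletCharacter ℂ q with χ.IsPrimitive, g q χ t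
        ≤ ∫ t in Set.Ioc (NX : ℝ) x, Bt * t⁻¹ := by
          refine setIntegral_mono_on (integrable_finsetSum _ fun q _ => integrable_finsetSum _ fun χ _ => hgi q χ)
            hBtint measurableSet_Ioc fun t ht => ?_
          have ht0 : 0 < t := hNXpos.trans ht.1
          have h1 := hsieve t ht
          have h2 : ∑ q ∈ Icc 1 ⌊P⌋₊, ∑ χ : DirichletCharacter ℂ q with χ.IsPrimitive, g q χ t =
              (∑ q ∈ Icc 1 ⌊P⌋₊, ∑ χ : DirichletCharacter ℂ q with χ.IsPrimitive,
                ∫ v in (-T')..T', ‖summatory (coefSifted χ v x z) t‖ ^ 2) / t := by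
            rw [sum_div]; refine sum_congr rfl fun q _ => ?_; rw [sum_div]
          rw [h2, div_eq_mul_inv]
          exact mul_le_mul_of_nonneg_right h1 (inv_nonneg.2 ht0.le)
      _ = Bt * Real.log (x / NX) := by
          rw [integral_const_mul, ← intervalIntegral.integral_of_le hNXx, integral_inv_of_pos hNXpos hxpos]
      _ ≤ Bt * Lx := by
          refine mul_le_mul_of_nonneg_left ?_ (by positivity)
          rw [Real.log_div hxpos.ne' hNXpos.ne', hlogx]
          linarith [Real.log_nonneg (show (1:ℝ) ≤ NX by exact_mod_cast hNX1)]
  have hmain := hstep1.trans (mul_le_mul_of_nonneg_left hstep3 (by positivity))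
  /- ── the final arithmetic ── -/
  have hK : C_z * (r * L') * (Bt * Lx) = r * (K₁ * Lp ^ 3) := by
    rw [hBt, hLx, hL', hK₁]; field_simp
  rw [hK] at hmain
  -- divide by `r L₀`
  have hdiv : S ≤ K₁ * Lp ^ 3 / L₀ := by
    rw [le_div_iff₀ hL₀pos]
    have h1 : r * (L₀ * S) ≤ r * (K₁ * Lp ^ 3) := by rw [← mul_assoc]; exact hmain
    have h2 := le_of_mul_le_mul_left h1 hrpos
    linarith [mul_comm L₀ S]
  refine hdiv.trans ?_
  -- `K₁ Lp³ / L₀ = K₁ e^{10} (r Lp)³ x^{r/10} ≤ K₁ e^{10} P^{A(1−α)}`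
  have hxr : x ^ (r / 10) = Real.exp (A₁ * B / 10 * r * Lp) := by
    rw [hx, ← Real.exp_mul, hLx, hL']; ring_nf
  have hL₀eq : K₁ * Lp ^ 3 / L₀ = 4 * K₁ * Real.exp 10 * ((r * Lp) ^ 3 * x ^ (r / 10)) := by
    rw [hL₀, Real.rpow_neg hxpos.le, Real.exp_neg]
    have hx10 : 0 < x ^ (r / 10) := by positivity
    field_simp
  rw [hL₀eq]
  have hcube : (r * Lp) ^ 3 ≤ Real.exp (3 * (r * Lp)) := cube_le_exp (by positivity)
  have hPpow : P ^ ((A₁ * B / 10 + 3) * 2 * (1 - α)) =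
      Real.exp (3 * (r * Lp)) * Real.exp (A₁ * B / 10 * r * Lp) := by
    rw [Real.rpow_def_of_pos hPpos, ← Real.exp_add, ← hLp, hr]; ring_nf
  rw [hPpow, hxr]
  refine mul_le_mul_of_nonneg_left ?_ (by positivity)
  exact mul_le_mul_of_nonneg_right hcube (Real.exp_pos _).le


/-! ### The range `1 − α < c₁/log P`: no zeros of `ζ` (zero-free region) -/

/-- **Near `α = 1` there are no zeros of `ζ`:** there is an absolute `c₁ > 0` such that for `P ≥ 2`
and `1 − α < c₁/log P`, `ζ` has no non-trivial zero with `β ≥ α`, `|γ| ≤ P^6` (de la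
Vallée-Poussin's region `β < 1 − c/log(|γ| + 4)`; `ζ` has no exceptional zero).
[cite: MontgomeryVaughan2007, Theorem 6.6] -/
theorem smallRangeZeta :
    ∃ c₁ : ℝ, 0 < c₁ ∧ ∀ P : ℝ, 2 ≤ P → ∀ α : ℝ, 1 - α < c₁ / Real.log P →
      ∑ ρ ∈ (weilZeroIndex_finite (P ^ 6)).toFinset with α ≤ ρ.re,
        ((riemannZetaZeroOrder ρ : ℤ) : ℝ) = 0 := by
  obtain ⟨c_ζ, hc_ζ, hZF⟩ := classicalZFRData_riemannZeta.zeroFree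
  refine ⟨min (c_ζ / 7) (1 / 4), by positivity, fun P hP α hα => ?_⟩
  set Lp := Real.log P with hLp
  have hlog2 : Real.log 2 ≤ Lp := Real.log_le_log (by norm_num) hP
  have hLp : 0.69 ≤ Lp := by
    have := Real.log_two_gt_d9
    linarith
  have hLppos : 0 < Lp := by linarith
  refine sum_eq_zero fun ρ hρ => ?_
  exfalso
  rw [mem_filter, Set.Finite.mem_toFinset] at hρ
  obtain ⟨⟨h0, hre0, hre1, him0, himT⟩, hαρ⟩ := hρ
  have hre1' : ρ.re < 1 := by
    by_contra h; exact riemannZeta_ne_zero_of_one_le_re (not_lt.1 h) h0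
  have hne1 : ρ ≠ 1 := by intro h; rw [h, one_re] at hre1'; exact lt_irrefl _ hre1'
  have hζ1 : riemannZeta₁ ρ = 0 := (riemannZeta₁_eq_zero_iff hne1).2 h0
  -- `1 − α < c₁/Lp ≤ (1/4)/0.69 < 1/2` and `≤ (c_ζ/7)/Lp ≤ c_ζ/log(|γ|+4)`
  have hc1 : min (c_ζ / 7) (1 / 4) / Lp ≤ (1 / 4) / Lp :=
    div_le_div_of_nonneg_right (min_le_right _ _) hLppos.le
  have hc2 : min (c_ζ / 7) (1 / 4) / Lp ≤ (c_ζ / 7) / Lp :=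
    div_le_div_of_nonneg_right (min_le_left _ _) hLppos.le
  have hquarter : (1 / 4) / Lp < 1 / 2 := by rw [div_lt_iff₀ hLppos]; linarith
  have hlogγ : Real.log (|ρ.im| + 4) ≤ 7 * Lp := by
    have hP6 : (64 : ℝ) ≤ P ^ (6 : ℕ) := by
      calc (64 : ℝ) = 2 ^ (6 : ℕ) := by norm_num
        _ ≤ P ^ (6 : ℕ) := pow_le_pow_left₀ (by norm_num) hP 6
    calc Real.log (|ρ.im| + 4) ≤ Real.log (2 * P ^ (6 : ℕ)) :=
          Real.log_le_log (by positivity) (by linarith)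
      _ = Real.log 2 + 6 * Lp := by
          rw [Real.log_mul (by norm_num) (by positivity), Real.log_pow]; norm_num; rfl
      _ ≤ 7 * Lp := by linarith
  have hlogγpos : 0 < Real.log (|ρ.im| + 4) := Real.log_pos (by linarith [abs_nonneg ρ.im])
  refine hZF ρ (by norm_num; linarith) ?_ hζ1
  have h3 : c_ζ / 7 / Lp ≤ c_ζ / Real.log (|ρ.im| + 4) := by
    rw [div_div, div_le_div_iff₀ (by positivity) hlogγpos]
    nlinarith [hc_ζ]
  linarith

/-! ### The range `1 − α > δ₀`: the trivial bound -/

/-- **Trivial bound for the number of zeros of `ζ` up to height `P^6`:** an absolute `C` with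
`∑_{ρ : 0 < |γ| ≤ P^6} m(ρ) ≤ C P^7` for `P ≥ 2` (the tree's window counts for `β ≥ 1/4`,
`ZeroDensityInghamHuxley.exists_sum_zeroOrder_le_mul_log`, and the reflection `ρ ↦ 1 − ρ`,
`m(1 − ρ) = m(ρ)`, for `β < 1/4`). [cite: MontgomeryVaughan2007, Thm. 10.13] -/
theorem largeRangeZeta :
    ∃ C : ℝ, 0 < C ∧ ∀ P : ℝ, 2 ≤ P →
      ∑ ρ ∈ (weilZeroIndex_finite (P ^ 6)).toFinset, ((riemannZetaZeroOrder ρ : ℤ) : ℝ) ≤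
        C * P ^ (7 : ℝ) := by
  classical
  obtain ⟨C_I, hC_I, hIH⟩ := exists_sum_zeroOrder_le_mul_log
  refine ⟨28 * C_I, by positivity, fun P hP => ?_⟩
  set U : ℝ := P ^ (6 : ℕ) with hU
  set W := (weilZeroIndex_finite (P ^ 6)).toFinset with hW
  have hP0 : 0 < P := by linarith
  have hU64 : (64 : ℝ) ≤ U := by
    calc (64 : ℝ) = 2 ^ (6 : ℕ) := by norm_num
      _ ≤ P ^ (6 : ℕ) := pow_le_pow_left₀ (by norm_num) hP 6
  have hU1 : 1 ≤ U := by linarith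
  have hmemW : ∀ ρ ∈ W, riemannZeta ρ = 0 ∧ 0 < ρ.re ∧ ρ.re < 1 ∧ |ρ.im| ≤ U := by
    intro ρ hρ
    rw [hW, Set.Finite.mem_toFinset, weilZeroIndex_eq_inter] at hρ
    exact ⟨ZetaZeros.riemannZetaNontrivialZeros.zeta_eq_zero hρ.1,
      ZetaZeros.riemannZetaNontrivialZeros.re_pos hρ.1,
      ZetaZeros.riemannZetaNontrivialZeros.re_lt_one hρ.1, hρ.2⟩
  -- split at `β = 1/4`
  set W₁ := W.filter (fun ρ => 1 / 4 ≤ ρ.re) with hW₁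
  set W₂ := W.filter (fun ρ => ¬ 1 / 4 ≤ ρ.re) with hW₂
  have hsplit : ∑ ρ ∈ W, ((riemannZetaZeroOrder ρ : ℤ) : ℝ) =
      ∑ ρ ∈ W₁, ((riemannZetaZeroOrder ρ : ℤ) : ℝ) + ∑ ρ ∈ W₂, ((riemannZetaZeroOrder ρ : ℤ) : ℝ) :=
    (sum_filter_add_sum_filter_not W (fun ρ => 1 / 4 ≤ ρ.re) _).symm
  have hB : C_I * (U + 2) * Real.log (U + 2) ≤ 14 * C_I * P ^ (7 : ℝ) := by
    have h1 : U + 2 ≤ 2 * U := by linarith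
    have h2 : Real.log (U + 2) ≤ 7 * Real.log P := by
      calc Real.log (U + 2) ≤ Real.log (2 * U) := Real.log_le_log (by positivity) h1
        _ = Real.log 2 + 6 * Real.log P := by
            rw [Real.log_mul (by norm_num) (by positivity), hU, Real.log_pow]; norm_num
        _ ≤ 7 * Real.log P := by
            have := Real.log_le_log (by norm_num) hP; linarith
    have h3 : Real.log P ≤ P := (Real.log_le_sub_one_of_pos hP0).trans (by linarith)
    have h4 : (P : ℝ) ^ (7 : ℝ) = U * P := by
      rw [hU, show (7 : ℝ) = ((7 : ℕ) : ℝ) by norm_num, Real.rpow_natCast]; ring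
    rw [h4]
    have hlog0 : 0 ≤ Real.log (U + 2) := Real.log_nonneg (by linarith)
    calc C_I * (U + 2) * Real.log (U + 2) ≤ C_I * (2 * U) * (7 * Real.log P) := by gcongr
      _ = 14 * C_I * (U * Real.log P) := by ring
      _ ≤ 14 * C_I * (U * P) := by gcongr
  -- part 1
  have hpart1 : ∑ ρ ∈ W₁, ((riemannZetaZeroOrder ρ : ℤ) : ℝ) ≤ C_I * (U + 2) * Real.log (U + 2) := by
    refine hIH U hU1 W₁ fun ρ hρ => ?_
    rw [hW₁, mem_filter] at hρ
    have h := hmemW ρ hρ.1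
    exact ⟨⟨h.1, hρ.2⟩, h.2.2.2⟩
  -- part 2: reflect
  have hpart2 : ∑ ρ ∈ W₂, ((riemannZetaZeroOrder ρ : ℤ) : ℝ) ≤ C_I * (U + 2) * Real.log (U + 2) := by
    have hinj : Set.InjOn (fun ρ : ℂ => 1 - ρ) (W₂ : Set ℂ) := fun a _ b _ h => by
      simpa using h
    have heq : ∑ ρ ∈ W₂, ((riemannZetaZeroOrder ρ : ℤ) : ℝ) =
        ∑ σ ∈ W₂.image (fun ρ => 1 - ρ), ((riemannZetaZeroOrder σ : ℤ) : ℝ) := by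
      rw [sum_image hinj]
      refine sum_congr rfl fun ρ hρ => ?_
      rw [hW₂, mem_filter] at hρ
      have h := hmemW ρ hρ.1
      rw [riemannZetaZeroOrder_one_sub_holds h.2.1 h.2.2.1]
    rw [heq]
    refine hIH U hU1 _ fun σ hσ => ?_
    rw [mem_image] at hσ
    obtain ⟨ρ, hρ, rfl⟩ := hσ
    rw [hW₂, mem_filter] at hρ
    have h := hmemW ρ hρ.1
    refine ⟨⟨GeneralizedRH.riemannZeta_one_sub_eq_zero h.1 h.2.1 h.2.2.1, ?_⟩, ?_⟩
    · simp only [sub_re, one_re]; push Not at hρ; linarith [hρ.2]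
    · simp only [sub_im, one_im, zero_sub, abs_neg]; exact h.2.2.2
  rw [hsplit]
  linarith

/-! ### The theorem for `ζ` -/

/-- **Bombieri's Théorème 14 for `ζ`, in the shape used by the tree** (*Le grand crible*, §6,
Théorème 14 with `q = 1`, combined with the zero-free region near `σ = 1` and the trivial count for
`1 − α > δ₀`; this is hypothesis `hZDζ` of `lemma43_gallagher_of_explicitFormula_of_density`): there
are absolute `c_D, C_D > 0` such that for `P ≥ 2` and `0 ≤ α ≤ 1`,
`∑_{ρ : ζ(ρ) = 0 non-trivial, |γ| ≤ P^6, β ≥ α} m(ρ) ≤ C_D P^{c_D(1−α)}`.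
[cite: Bombieri1987GrandCrible, §6 Théorème 14] -/
theorem logFreeDensity_zeta :
    ∃ c_D C_D : ℝ, 0 < c_D ∧ 0 < C_D ∧
      ∀ P : ℝ, 2 ≤ P → ∀ α : ℝ, 0 ≤ α → α ≤ 1 →
        ∑ ρ ∈ (weilZeroIndex_finite (P ^ 6)).toFinset with α ≤ ρ.re,
          ((riemannZetaZeroOrder ρ : ℤ) : ℝ) ≤ C_D * P ^ (c_D * (1 - α)) := by
  classical
  obtain ⟨c₁, hc₁, hsmall⟩ := smallRangeZeta
  obtain ⟨δ₀, A, C, hδ₀, hA, hC, hmid⟩ := middleRangeZeta hc₁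
  obtain ⟨C₃, hC₃, hlarge⟩ := largeRangeZeta
  refine ⟨max A (7 / δ₀), max (max 1 C) C₃, by positivity, by positivity, fun P hP α hα0 hα1 => ?_⟩
  have hP1 : (1 : ℝ) ≤ P := by linarith
  have hCD1 : (1 : ℝ) ≤ max (max 1 C) C₃ := (le_max_left _ _).trans (le_max_left _ _)
  have hpow1 : (1 : ℝ) ≤ P ^ (max A (7 / δ₀) * (1 - α)) :=
    Real.one_le_rpow hP1 (mul_nonneg (by positivity) (by linarith))
  rcases lt_or_ge (1 - α) (c₁ / Real.log P) with h1 | h1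
  · rw [hsmall P hP α h1]
    nlinarith
  rcases le_or_gt (1 - α) δ₀ with h2 | h2
  · refine (hmid P hP α h1 h2).trans ?_
    have hP' : P ^ (A * (1 - α)) ≤ P ^ (max A (7 / δ₀) * (1 - α)) :=
      Real.rpow_le_rpow_of_exponent_le hP1 (mul_le_mul_of_nonneg_right (le_max_left _ _) (by linarith))
    calc C * P ^ (A * (1 - α)) ≤ C * P ^ (max A (7 / δ₀) * (1 - α)) :=
          mul_le_mul_of_nonneg_left hP' hC.le
      _ ≤ _ := mul_le_mul_of_nonneg_right ((le_max_right _ _).trans (le_max_left _ _)) (by positivity)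
  · have hsub : ∑ ρ ∈ (weilZeroIndex_finite (P ^ 6)).toFinset with α ≤ ρ.re,
        ((riemannZetaZeroOrder ρ : ℤ) : ℝ) ≤
        ∑ ρ ∈ (weilZeroIndex_finite (P ^ 6)).toFinset, ((riemannZetaZeroOrder ρ : ℤ) : ℝ) := by
      refine sum_le_sum_of_subset_of_nonneg (filter_subset _ _) fun ρ hρ _ => ?_
      rw [Set.Finite.mem_toFinset, weilZeroIndex_eq_inter] at hρ
      exact_mod_cast riemannZetaZeroOrder_nonneg (ZetaZeros.riemannZetaNontrivialZeros.ne_one hρ.1)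
    refine (hsub.trans (hlarge P hP)).trans ?_
    have h7 : (7 : ℝ) ≤ max A (7 / δ₀) * (1 - α) := by
      have : 7 / δ₀ * δ₀ ≤ max A (7 / δ₀) * (1 - α) :=
        mul_le_mul (le_max_right _ _) h2.le hδ₀.le (by positivity)
      rwa [div_mul_cancel₀ _ hδ₀.ne'] at this
    calc C₃ * P ^ (7 : ℝ) ≤ C₃ * P ^ (max A (7 / δ₀) * (1 - α)) :=
          mul_le_mul_of_nonneg_left (Real.rpow_le_rpow_of_exponent_le hP1 h7) hC₃.le
      _ ≤ _ := mul_le_mul_of_nonneg_right (le_max_right _ _) (by positivity)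

end Literature.NumberTheory.LFunctions.LogFreeDensity
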